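import Mathlib
import Summits.Ventures.PercRepro2.SwAllHMarkDefs
import Summits.Ventures.PercRepro2.SwOutArmGTyped

/-!
# THE GENERAL MARK STEP, I: the cluster transport through an arbitrary vertex and the side of
the mark as a doubly typed class of the isolated graph
(blind cell PercRepro2, night-4 g31, 2026-08-28; proofs/NIGHT4-G31.md)

Let `x` be ANY vertex (any degree, any neighbours — `l`, `h` and loops included) and
`isolate ends x` the graph with the edges at `x` deleted (loops at `x`, `SwAllHMarkDefs`).  For a
colouring `ω` the OPEN NEIGHBOURS `openNbrs ends ω x` are the vertices `y ≠ x` joined to `x` by an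
open edge.  **Cluster transport** (`cluster_transport_isolate`): for a root `v ≠ x`, `x` is in the
cluster of `v` iff some open neighbour of `x` is in the cluster of `v` of the isolated graph, and a
vertex `w ≠ x` is in the cluster of `v` iff it is in the isolated cluster of `v`, or `x` is in the
cluster of `v` and `w` is in the isolated cluster of some open neighbour of `x`.  Hence the side
`Q_x = {h ∉ H_l, x ∈ C_R(l) ∖ C_B(l)}` of row 2′SW-ALL reads, in the isolated graph, with
`R = openNbrs ends ζ x` (the red neighbours) and `B = openNbrs ends (blue ζ) x` (the blue ones):
`C_R(l)` meets `R`, `C_B(l)` avoids `B`, `h ∉ H_l`, `C_R(h)` avoids `R` (`mem_tgt_iff_isolate`) —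
EXACTLY the general doubly typed class of night-4 g7 on the isolated graph,
`gTypedQ (isolate ends x) l h (markU ends ζ x) (markD ends ζ x) (markD'' ends ζ x) {x} univ`
(`mem_tgt_iff_gTypedQ`; the families depend on the bits at `x` only: `markU_eq_of_agree` …).
On `Q_x` the red edge set of `h` is that of the isolated graph (`redEdges_eq_isolate_of_mem_tgt`).
Theorem (next file): row 2′SW-ALL with the mark at `x` from the doubly typed row of the isolated
graph on every colour pattern of the edges at `x`.
-/

namespace Summit.Ventures.PercRepro2

namespace LocRows

open Hull

variable {V : Type*} {E : Type*}

open scoped Classical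

section Nbrs

variable (ends : E → Sym2 V)

/-- The open neighbours of `x`: the vertices `y ≠ x` joined to `x` by an open edge of `ω`. -/
def openNbrs (ω : Config E) (x : V) : Set V :=
  {y | y ≠ x ∧ ∃ e, ω e = true ∧ ends e = s(x, y)}

/-- The up-set `{S ∣ S meets the open neighbours of x}` (the red neighbours for `d = ζ`). -/
def markU (d : Config E) (x : V) : Set (Set V) := {S | ∃ y ∈ openNbrs ends d x, y ∈ S}

/-- The down-set `{S ∣ S avoids the blue neighbours of x}`. -/
def markD (d : Config E) (x : V) : Set (Set V) := {S | ∀ y ∈ openNbrs ends (blue d) x, y ∉ S}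

/-- The down-set `{S ∣ S avoids the red neighbours of x}`. -/
def markD'' (d : Config E) (x : V) : Set (Set V) := {S | ∀ y ∈ openNbrs ends d x, y ∉ S}

variable {ends}

/-- Membership in the open neighbours. -/
lemma mem_openNbrs {ω : Config E} {x y : V} :
    y ∈ openNbrs ends ω x ↔ y ≠ x ∧ ∃ e, ω e = true ∧ ends e = s(x, y) := Iff.rfl

/-- An open edge at `x` to `y ≠ x` makes `y` an open neighbour. -/
lemma mem_openNbrs_of_edge {ω : Config E} {x y : V} {e : E} (hyx : y ≠ x) (he : ω e = true)
    (hends : ends e = s(x, y)) : y ∈ openNbrs ends ω x := ⟨hyx, e, he, hends⟩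

/-- An open neighbour of `x` lies in the cluster of `x`. -/
lemma mem_cluster_of_mem_openNbrs {ω : Config E} {x y : V} (hy : y ∈ openNbrs ends ω x) :
    y ∈ cluster ends ω x := by
  obtain ⟨-, e, he, hends⟩ := hy
  exact mem_cluster_of_edge (mem_cluster_self _ _ _) he hends

/-- The open neighbours depend on the bits at `x` only. -/
lemma openNbrs_eq_of_agree {ω ω' : Config E} {x : V} (hag : ∀ e, x ∈ ends e → ω' e = ω e) :
    openNbrs ends ω' x = openNbrs ends ω x := by
  ext y
  simp only [mem_openNbrs]
  constructor
  · rintro ⟨hyx, e, he, hends⟩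
    refine ⟨hyx, e, ?_, hends⟩
    rw [← hag e (by rw [hends]; exact Sym2.mem_mk_left _ _)]
    exact he
  · rintro ⟨hyx, e, he, hends⟩
    refine ⟨hyx, e, ?_, hends⟩
    rw [hag e (by rw [hends]; exact Sym2.mem_mk_left _ _)]
    exact he

/-- `markU` is an up-set. -/
lemma isUpperSet_markU (d : Config E) (x : V) : IsUpperSet (markU ends d x) := by
  rintro S S' hSS' ⟨y, hy, hyS⟩
  exact ⟨y, hy, hSS' hyS⟩

/-- `markD` is a down-set. -/
lemma isLowerSet_markD (d : Config E) (x : V) : IsLowerSet (markD ends d x) :=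
  fun _ _ hS'S hS y hy hyS' => hS y hy (hS'S hyS')

/-- `markD''` is a down-set. -/
lemma isLowerSet_markD'' (d : Config E) (x : V) : IsLowerSet (markD'' ends d x) :=
  fun _ _ hS'S hS y hy hyS' => hS y hy (hS'S hyS')

/-- The families depend on the bits at `x` only. -/
lemma markU_eq_of_agree {d d' : Config E} {x : V} (hag : ∀ e, x ∈ ends e → d' e = d e) :
    markU ends d' x = markU ends d x := by
  simp only [markU, openNbrs_eq_of_agree hag]

/-- The families depend on the bits at `x` only. -/
lemma markD_eq_of_agree {d d' : Config E} {x : V} (hag : ∀ e, x ∈ ends e → d' e = d e) :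
    markD ends d' x = markD ends d x := by
  have hagb : ∀ e, x ∈ ends e → blue d' e = blue d e := fun e he => by
    rw [blue_apply, blue_apply, hag e he]
  simp only [markD, openNbrs_eq_of_agree hagb]

/-- The families depend on the bits at `x` only. -/
lemma markD''_eq_of_agree {d d' : Config E} {x : V} (hag : ∀ e, x ∈ ends e → d' e = d e) :
    markD'' ends d' x = markD'' ends d x := by
  simp only [markD'', openNbrs_eq_of_agree hag]

end Nbrs

section Transport

variable {ends : E → Sym2 V} {x : V}

/-- **Cluster transport through an arbitrary vertex `x`**, for a root `v ≠ x`: `x` is in the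
cluster of `v` iff some open neighbour of `x` is in the cluster of `v` of the isolated graph; a
vertex `w ≠ x` is in the cluster of `v` iff it is in the isolated cluster of `v`, or `x` is in the
cluster of `v` and `w` is in the isolated cluster of some open neighbour of `x`. -/
theorem cluster_transport_isolate {ω : Config E} {v : V} (hv : v ≠ x) :
    (x ∈ cluster ends ω v ↔ ∃ y ∈ openNbrs ends ω x, y ∈ cluster (isolate ends x) ω v) ∧
    ∀ w, w ≠ x → (w ∈ cluster ends ω v ↔ w ∈ cluster (isolate ends x) ω v ∨
      (x ∈ cluster ends ω v ∧ ∃ y ∈ openNbrs ends ω x, w ∈ cluster (isolate ends x) ω y)) := by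
  set N := openNbrs ends ω x with hN
  have hxin : (∃ y ∈ N, y ∈ cluster (isolate ends x) ω v) → x ∈ cluster ends ω v := by
    rintro ⟨y, ⟨-, e, he, hends⟩, hy⟩
    exact mem_cluster_of_edge (cluster_isolate_subset ω v hy) he (ends_swap hends)
  have hS : cluster ends ω v ⊆ {w | (w ≠ x ∧ (w ∈ cluster (isolate ends x) ω v ∨
      ((∃ y ∈ N, y ∈ cluster (isolate ends x) ω v) ∧
        ∃ y ∈ N, w ∈ cluster (isolate ends x) ω y))) ∨
      (w = x ∧ ∃ y ∈ N, y ∈ cluster (isolate ends x) ω v)} := by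
    intro w hw
    refine mem_of_conn_of_closed (ends := ends) (ω := ω) ?_
      (Or.inl ⟨hv, Or.inl (mem_cluster_self _ _ _)⟩) hw
    rintro a ha b hab
    obtain ⟨hne, e, he, hends⟩ := openGraph_adj.1 hab
    by_cases hbx : b = x
    · -- entering `x` through the open edge `e` from `a ≠ x`: `a` is an open neighbour of `x`
      subst hbx
      have haN : a ∈ N := ⟨hne, e, he, ends_swap hends⟩
      refine Or.inr ⟨rfl, ?_⟩
      rcases ha with ⟨-, ha' | ⟨hy, -⟩⟩ | ⟨hax, -⟩
      · exact ⟨a, haN, ha'⟩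
      · exact hy
      · exact absurd hax hne
    · by_cases hax : a = x
      · -- leaving `x` through the open edge `e` to `b ≠ x`: `b` is an open neighbour of `x`
        subst hax
        have hbN : b ∈ N := ⟨hbx, e, he, hends⟩
        rcases ha with ⟨hax', -⟩ | ⟨-, hy⟩
        · exact absurd rfl hax'
        · exact Or.inl ⟨hbx, Or.inr ⟨hy, b, hbN, mem_cluster_self _ _ _⟩⟩
      · -- an edge avoiding `x`: an edge of the isolated graph
        have hends' : isolate ends x e = s(a, b) := isolate_eq_of_ends_eq hax hbx hends
        refine Or.inl ⟨hbx, ?_⟩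
        rcases ha with ⟨-, ha' | ⟨hy, y, hyN, hay⟩⟩ | ⟨hax', -⟩
        · exact Or.inl (mem_cluster_of_edge ha' he hends')
        · exact Or.inr ⟨hy, y, hyN, mem_cluster_of_edge hay he hends'⟩
        · exact absurd hax' hax
  refine ⟨⟨fun hx => ?_, hxin⟩, fun w hw => ⟨fun hw' => ?_, ?_⟩⟩
  · rcases hS hx with ⟨hxx, -⟩ | ⟨-, hy⟩
    · exact absurd rfl hxx
    · exact hy
  · rcases hS hw' with ⟨-, hw'' | ⟨hy, hy'⟩⟩ | ⟨hwx, -⟩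
    · exact Or.inl hw''
    · exact Or.inr ⟨hxin hy, hy'⟩
    · exact absurd hwx hw
  · rintro (hw' | ⟨hx, y, hyN, hwy⟩)
    · exact cluster_isolate_subset ω v hw'
    · have hyv : y ∈ cluster ends ω v := conn_trans hx (mem_cluster_of_mem_openNbrs hyN)
      exact conn_trans hyv (cluster_isolate_subset ω y hwy)

/-- `x` is in the cluster of `v ≠ x` iff some open neighbour of `x` is in the isolated cluster
of `v`. -/
lemma x_mem_cluster_iff_isolate {ω : Config E} {v : V} (hv : v ≠ x) :
    x ∈ cluster ends ω v ↔ ∃ y ∈ openNbrs ends ω x, y ∈ cluster (isolate ends x) ω v :=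
  (cluster_transport_isolate hv).1

/-- A vertex `w ≠ x` is in the cluster of `v ≠ x` iff it is in the isolated cluster of `v`, or
`x` is in the cluster of `v` and `w` is in the isolated cluster of an open neighbour of `x`. -/
lemma mem_cluster_iff_isolate {ω : Config E} {v w : V} (hv : v ≠ x) (hw : w ≠ x) :
    w ∈ cluster ends ω v ↔ w ∈ cluster (isolate ends x) ω v ∨
      (x ∈ cluster ends ω v ∧ ∃ y ∈ openNbrs ends ω x, w ∈ cluster (isolate ends x) ω y) :=
  (cluster_transport_isolate hv).2 w hw

/-- Cluster membership is symmetric. -/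
lemma mem_cluster_comm {ω : Config E} {a b : V} :
    a ∈ cluster ends ω b ↔ b ∈ cluster ends ω a :=
  ⟨fun h' => conn_symm h', fun h' => conn_symm h'⟩

end Transport

section Side

variable [Fintype E] [DecidableEq E]

variable {ends : E → Sym2 V} {x l h : V} (hxl : x ≠ l) (hxh : x ≠ h)
include hxl hxh

/-- **The side of the mark `x` in the isolated graph**: with `R` the red and `B` the blue
neighbours of `x`, the red cluster of `l` meets `R`, the blue cluster of `l` avoids `B`, `h` is in
neither isolated cluster of `l`, and the red cluster of `h` avoids `R`. -/
theorem mem_tgt_iff_isolate {ζ : Config E} :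
    ζ ∈ tgtU ends l h {S : Set V | x ∈ S} ↔
      (∃ y ∈ openNbrs ends ζ x, y ∈ cluster (isolate ends x) ζ l) ∧
      (∀ y ∈ openNbrs ends (blue ζ) x, y ∉ cluster (isolate ends x) (blue ζ) l) ∧
      h ∉ cluster (isolate ends x) ζ l ∧ h ∉ cluster (isolate ends x) (blue ζ) l ∧
      ∀ y ∈ openNbrs ends ζ x, y ∉ cluster (isolate ends x) ζ h := by
  rw [LocRows.mem_tgt_iff]
  have hlx : l ≠ x := hxl.symm
  have hhx : h ≠ x := hxh.symm
  constructor
  · rintro ⟨hh, hxR, hxB⟩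
    have hhR : h ∉ cluster ends ζ l := fun h' => hh (Or.inl h')
    have hhB : h ∉ cluster ends (blue ζ) l := fun h' => hh (Or.inr h')
    refine ⟨(x_mem_cluster_iff_isolate hlx).1 hxR, ?_, ?_, ?_, ?_⟩
    · intro y hy hyB
      exact hxB ((x_mem_cluster_iff_isolate (ω := blue ζ) hlx).2 ⟨y, hy, hyB⟩)
    · exact fun h' => hhR (cluster_isolate_subset ζ l h')
    · exact fun h' => hhB (cluster_isolate_subset (blue ζ) l h')
    · intro y hy hyh
      have hyl : y ∈ cluster ends ζ l := conn_trans hxR (mem_cluster_of_mem_openNbrs hy)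
      exact notMem_cluster_h_of_mem_cluster_l hh hyl (cluster_isolate_subset ζ h hyh)
  · rintro ⟨hxR', hxB', hhR', hhB', hRh⟩
    have hxR : x ∈ cluster ends ζ l := (x_mem_cluster_iff_isolate hlx).2 hxR'
    have hxB : x ∉ cluster ends (blue ζ) l := by
      intro hx
      obtain ⟨y, hy, hyB⟩ := (x_mem_cluster_iff_isolate (ω := blue ζ) hlx).1 hx
      exact hxB' y hy hyB
    refine ⟨?_, hxR, hxB⟩
    rintro (hh | hh)
    · rcases (mem_cluster_iff_isolate hlx hhx).1 hh with hh' | ⟨-, y, hy, hhy⟩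
      · exact hhR' hh'
      · exact hRh y hy (mem_cluster_comm.1 hhy)
    · rcases (mem_cluster_iff_isolate (ω := blue ζ) hlx hhx).1 hh with hh' | ⟨hx, -⟩
      · exact hhB' hh'
      · exact hxB hx

omit hxl in
/-- **On the side of the mark the red edge set of `h` is that of the isolated graph.** -/
lemma redEdges_eq_isolate_of_mem_tgt {ζ : Config E}
    (hζ : ζ ∈ tgtU ends l h {S : Set V | x ∈ S}) :
    redEdges ends ζ h = redEdges (isolate ends x) ζ h := by
  have hC : cluster ends ζ h = cluster (isolate ends x) ζ h :=
    cluster_eq_isolate_of_notMem (x_notMem_cluster_h hζ)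
  ext e
  simp only [mem_redEdges]
  rw [hC, within_isolate_eq (x_notMem_cluster_isolate hxh.symm)]

/-- **The side of the mark is the general doubly typed class of the isolated graph** at the
families of its own red and blue neighbours (`𝓤 = {S ∣ S meets R}`, `𝓓 = {S ∣ S avoids B}`,
`𝓓″ = {S ∣ S avoids R}`, `X = {x}`, `𝓤′ = univ`). -/
theorem mem_tgt_iff_gTypedQ {ζ : Config E} :
    ζ ∈ tgtU ends l h {S : Set V | x ∈ S} ↔
      ζ ∈ gTypedQ (isolate ends x) l h (markU ends ζ x) (markD ends ζ x) (markD'' ends ζ x)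
        {x} Set.univ := by
  rw [mem_tgt_iff_isolate hxl hxh, mem_gTypedQ]
  have hhx : h ≠ x := hxh.symm
  simp only [markU, markD, markD'', Set.mem_setOf_eq, Set.mem_singleton_iff, forall_eq,
    Set.mem_univ, and_true]
  constructor
  · rintro ⟨h1, h2, h3, h4, h5⟩
    refine ⟨fun h' => h'.elim h3 h4, h1, h2, h5, ?_⟩
    rintro (h' | h')
    · exact x_notMem_cluster_isolate hhx h'
    · exact x_notMem_cluster_isolate hhx h'
  · rintro ⟨hh, h1, h2, h5, -⟩
    exact ⟨h1, h2, fun h' => hh (Or.inl h'), fun h' => hh (Or.inr h'), h5⟩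

end Side

end LocRows

end Summit.Ventures.PercRepro2
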